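import Literature.IUT.HodgeArakelov.LabelClassesOfCuspsCor24iGraphTower
import HarnessLib

/-!
# [IUTchII] Cor 2.4 (i), inputs (B)+(C): the "[cf. also [CombGC], Proposition 1.2, (ii)]" form — incidence detected by OPEN subgroups of the inertia group; no tower-placement binder

S. Mochizuki, *Inter-universal Teichmüller Theory II*, kurims manuscript (Dec. 2020), §2, Cor 2.4 (i), proof p.70 l.−2 –
p.71 l.1: "by applying the equivalence of [IUTchI], Corollary 2.3, (vi) [cf. also [CombGC], Proposition 1.2, (ii)], to the
various finite index open subgroups of `Δ^±_v`"; Def 2.3 (ii) p.68 ("the cuspidal inertia groups of `Π_⊆` may be obtained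
as the intersections with `Π_⊆` of those cuspidal inertia groups of `Π_⊇` that contain a finite index subgroup that lies
inside `Π_⊆` … [cf. [CombGC], Proposition 1.2, (ii)]"), Rmk 2.3.1 p.69 ("`I ∩ Π_⊆ = I^l`"); *… I* (May 2020), §2, Cor 2.3
(vi) p.48; Mochizuki, *[CombGC]*, Prop 1.2 (ii) (a cusp is determined by any open subgroup of its edge-like subgroup)
[cite: Mochizuki2012, II Cor 2.4 (i) pp.70-71] (D-0012 claim key, status disputed; PROOF-ONLY — no definition, nothing of the
series asserted; abc-iut cell, seat abc-iut-w5-d121; node `IUTchII:Cor2.4(i)` inputs (B)/(C), GAP-LEDGER G-w4d012-2).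

WHY.  The node's `I_t` is a cuspidal inertia group of `Π_v`, i.e. (Def 2.3 (ii)′, Rmk 2.3.1) a FINITE-INDEX subgroup `I' ∩ Π_v`
of a cuspidal inertia group `I' = t I_x t⁻¹` of `Π^±_v`.  The closers p419450 … p421400 feed abc-iut-L5-t11's B3 `LevelIncidence`
(Cor 2.3 (vi) at level `i` for the FULL level-`i` inertia group) and so need the levels INSIDE `Π̂_v` (binders `hlevV`, `hinf`;
on the admissible route this silently requires `Ker(Δ̂_{X_v} ↠ Π̂_𝔾) ⊆ Δ̂_v`, GAP-LEDGER D-row 04:2xZ).  Print instead cites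
"[CombGC], Proposition 1.2, (ii)": incidence is detected by ANY finite-index subgroup of the inertia group.  Here the per-level
argument runs with that form of the input — binder `hincO`, "[IUTchI] Cor 2.3 (vi) + [CombGC] Prop 1.2 (ii) at level `i`" (a
HYPOTHESIS over abc-iut-L5-t11's carrier; it implies `LevelIncidence`) — and NO tower-placement binder: § 1 the per-level
target for a finite-index `I_D ⊆ t I_x t⁻¹` (`levelTarget_fi_of_inputs`, `levelTarget_fi_hat`); § 2
`StableCurveAgreement.mem_deltaPmBox_of_openIncidence` / `…_of_graphTowerOpen` (`γ' ∈ Δ^±_{v□}` without `hlevV`/`hinf`); § 3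
closers `cor24_i'_of_openIncidence_byGraph` / `cor24_ii_iii'_of_openIncidence_byGraph` over the admissible-tower adapter of
p421400.  PROVED (kernel); every [IUTchI]/[IUTchII]/[CombGC] statement is a HYPOTHESIS; typed ≠ proved; nothing here
bears on [IUTchIII] Cor 3.12.
-/

universe u

/-! ## § 1. The per-level target for finite-index subgroups of the inertia group -/

namespace Literature.IUT.HodgeTheaters

open Topology
open scoped Pointwise

namespace StableCurveTemperedData
variable {D : StableCurveTemperedData.{u}}
namespace Prop24Tower
namespace SubgraphLevelData
variable {T : D.Prop24Tower} (L : T.SubgraphLevelData)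

/-- **IUTchI:Cor2.3(vi)** with **[CombGC] Prop 1.2 (ii)** (kurims I p.48; II p.71 l.1) The open-subgroup incidence input implies
abc-iut-L5-t11's B3 `LevelIncidence` (`M` = the whole level-`i` inertia group). PROVED. [claim: Mochizuki2012, status: disputed] -/
theorem levelIncidence_of_open
    (hincO : ∀ i (x : D.Cusp) (t : D.PiTp) (M : Subgroup D.PiTp),
      M ≤ MulAut.conj t • ((D.inertiaTp x).map D.DeltaTp.subtype) ⊓ (D.levelTp (T.Jhat i)).map D.DeltaTp.subtype →
      M.relIndex (MulAut.conj t • ((D.inertiaTp x).map D.DeltaTp.subtype) ⊓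
        (D.levelTp (T.Jhat i)).map D.DeltaTp.subtype) ≠ 0 →
      (∃ j ∈ (D.levelTp (T.Jhat i)).map D.DeltaTp.subtype,
        M ≤ MulAut.conj j • ((D.deltaTpH ⊓ D.levelTp (T.Jhat i)).map D.DeltaTp.subtype)) →
      L.act i t (L.vtxCusp i x) ∈ L.compH i) :
    L.LevelIncidence := fun i x t hyp =>
  hincO i x t _ le_rfl (by rw [Subgroup.relIndex_self]; exact one_ne_zero) hyp

/-- **IUTchII:Cor2.4(i)** (kurims p.70 l.−2 – p.71 l.3, ONE level, "[cf. also [CombGC], Proposition 1.2, (ii)]" form)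
For a cusp `t·x̃`, a level `i` and `I_D ⊆ t I_x t⁻¹` of FINITE INDEX with `I_D ⊆ Δ^tp_{X,ℍ}` (e.g. `I' ∩ Π_v`): every
`γ ∈ Δ^tp_X` with `I_D^γ ⊆ Δ^tp_{X,ℍ}` lies in `Δ^tp_{X,ℍ} · J_i` — incidence (`hincO`) detected by the finite-index subgroups
`I_D ∩ J_i`, `(I_D ∩ J_i)^γ` of the level-`i` inertia groups, then `IsBlock`, `StabLeDeltaHLevel`; HYPOTHESES.  PROVED.
[claim: Mochizuki2012, status: disputed] -/
theorem levelTarget_fi_of_inputs (hN : T.LevelsNormal)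
    (hincO : ∀ i (x : D.Cusp) (t : D.PiTp) (M : Subgroup D.PiTp),
      M ≤ MulAut.conj t • ((D.inertiaTp x).map D.DeltaTp.subtype) ⊓ (D.levelTp (T.Jhat i)).map D.DeltaTp.subtype →
      M.relIndex (MulAut.conj t • ((D.inertiaTp x).map D.DeltaTp.subtype) ⊓
        (D.levelTp (T.Jhat i)).map D.DeltaTp.subtype) ≠ 0 →
      (∃ j ∈ (D.levelTp (T.Jhat i)).map D.DeltaTp.subtype,
        M ≤ MulAut.conj j • ((D.deltaTpH ⊓ D.levelTp (T.Jhat i)).map D.DeltaTp.subtype)) →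
      L.act i t (L.vtxCusp i x) ∈ L.compH i)
    (hblk : L.IsBlock) (hstab : L.StabLeDeltaHLevel) (i : T.I) (x : D.Cusp) (t : D.PiTp) (ID : Subgroup D.PiTp)
    (hID : ID ≤ MulAut.conj t • ((D.inertiaTp x).map D.DeltaTp.subtype))
    (hfi : ID.relIndex (MulAut.conj t • ((D.inertiaTp x).map D.DeltaTp.subtype)) ≠ 0)
    (hmeet : ID ≤ D.deltaTpH.map D.DeltaTp.subtype) (γ : D.DeltaTp)
    (hc : MulAut.conj (γ : D.PiTp) • ID ≤ D.deltaTpH.map D.DeltaTp.subtype) :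
    ∃ k ∈ D.deltaTpH, k⁻¹ * γ ∈ D.levelTp (T.Jhat i) := by
  haveI := T.levelTp_normal hN i
  set Ii : Subgroup D.PiTp := MulAut.conj t • ((D.inertiaTp x).map D.DeltaTp.subtype) with hIi
  set Ji : Subgroup D.PiTp := (D.levelTp (T.Jhat i)).map D.DeltaTp.subtype with hJi
  -- a subgroup whose `J_i`-part lies in `Δ^tp_{X,ℍ}` satisfies the incidence hypothesis with `j = 1`
  have key : ∀ K : Subgroup D.PiTp, K ≤ D.deltaTpH.map D.DeltaTp.subtype →
      ∃ j ∈ Ji, K ⊓ Ji ≤ MulAut.conj j • ((D.deltaTpH ⊓ D.levelTp (T.Jhat i)).map D.DeltaTp.subtype) := by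
    intro K hK
    refine ⟨1, one_mem _, ?_⟩
    rw [map_one, one_smul]
    intro y hy
    obtain ⟨j, hj, hjy⟩ := hy.2
    obtain ⟨d, hd, hdy⟩ := hK hy.1
    have : j = d := Subtype.ext (hjy.trans hdy.symm)
    subst this
    exact ⟨j, ⟨hd, hj⟩, hjy⟩
  -- `J_i` is stable under conjugation by `γ ∈ Δ^tp_X`
  have hJγ : MulAut.conj (γ : D.PiTp) • Ji = Ji := by
    ext y
    rw [Subgroup.mem_pointwise_smul_iff_inv_smul_mem]
    constructor
    · rintro ⟨j, hj, hjy⟩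
      refine ⟨γ * j * γ⁻¹, (T.levelTp_normal hN i).conj_mem j hj γ, ?_⟩
      rw [MulAut.smul_def, MulAut.conj_inv_apply] at hjy
      have e : y = (γ : D.PiTp) * ((γ : D.PiTp)⁻¹ * y * γ) * (γ : D.PiTp)⁻¹ := by group
      rw [e, ← hjy]
      simp
    · rintro ⟨j, hj, hjy⟩
      refine ⟨γ⁻¹ * j * γ, ?_, ?_⟩
      · simpa using (T.levelTp_normal hN i).conj_mem j hj γ⁻¹
      · rw [← hjy, MulAut.smul_def, MulAut.conj_inv_apply]
        simp
  -- base level `i` incidence for the cusp `t·x̃`, detected by `I_D ∩ J_i`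
  have h0 : L.act i t (L.vtxCusp i x) ∈ L.compH i :=
    hincO i x t (ID ⊓ Ji) (inf_le_inf_right Ji hID) (Subgroup.relIndex_inter_ne_zero hfi Ji)
      (key ID hmeet)
  -- incidence for the cusp `γt·x̃`, detected by `(I_D ∩ J_i)^γ`
  have hle : MulAut.conj (γ : D.PiTp) • (ID ⊓ Ji) ≤
      MulAut.conj ((γ : D.PiTp) * t) • ((D.inertiaTp x).map D.DeltaTp.subtype) ⊓ Ji := by
    rw [Subgroup.smul_inf, hJγ, map_mul, mul_smul]
    exact inf_le_inf_right Ji (Subgroup.pointwise_smul_le_pointwise_smul_iff.mpr hID)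
  have hfi' : (MulAut.conj (γ : D.PiTp) • (ID ⊓ Ji)).relIndex
      (MulAut.conj ((γ : D.PiTp) * t) • ((D.inertiaTp x).map D.DeltaTp.subtype) ⊓ Ji) ≠ 0 := by
    have e : MulAut.conj ((γ : D.PiTp) * t) • ((D.inertiaTp x).map D.DeltaTp.subtype) ⊓ Ji =
        MulAut.conj (γ : D.PiTp) • (Ii ⊓ Ji) := by
      rw [Subgroup.smul_inf, hJγ, map_mul, mul_smul]
    rw [e, Subgroup.relIndex_pointwise_smul]
    exact Subgroup.relIndex_inter_ne_zero hfi Ji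
  have hsub : ∃ j ∈ Ji, MulAut.conj (γ : D.PiTp) • (ID ⊓ Ji) ≤
      MulAut.conj j • ((D.deltaTpH ⊓ D.levelTp (T.Jhat i)).map D.DeltaTp.subtype) := by
    obtain ⟨j, hj, hle'⟩ := key (MulAut.conj (γ : D.PiTp) • ID) hc
    refine ⟨j, hj, le_trans ?_ hle'⟩
    rw [Subgroup.smul_inf, hJγ]
  have h1 : L.act i ((γ : D.PiTp) * t) (L.vtxCusp i x) ∈ L.compH i := hincO i x _ _ hle hfi' hsub
  rw [map_mul, Equiv.Perm.mul_apply] at h1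
  exact hstab i γ (hblk i (γ : D.PiTp) ⟨_, h0, h1⟩)

/-- **IUTchII:Cor2.4(i)** (kurims p.71 l.1–3, ONE level, open-subgroup form, `Π̂_X` side): for `J ⊆ ι(t I_x t⁻¹)` of finite
index, `J ⊆ ι(Δ^tp_{X,ℍ})`, `J^{g'} ⊆ ι(Δ^tp_{X,ℍ})` (`g'` tempered geometric): `g' ∈ ι(Δ^tp_{X,ℍ})·Ĵ_i`. PROVED. [claim: Mochizuki2012, status: disputed] -/
theorem levelTarget_fi_hat (hN : T.LevelsNormal)
    (hincO : ∀ i (x : D.Cusp) (t : D.PiTp) (M : Subgroup D.PiTp),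
      M ≤ MulAut.conj t • ((D.inertiaTp x).map D.DeltaTp.subtype) ⊓ (D.levelTp (T.Jhat i)).map D.DeltaTp.subtype →
      M.relIndex (MulAut.conj t • ((D.inertiaTp x).map D.DeltaTp.subtype) ⊓
        (D.levelTp (T.Jhat i)).map D.DeltaTp.subtype) ≠ 0 →
      (∃ j ∈ (D.levelTp (T.Jhat i)).map D.DeltaTp.subtype,
        M ≤ MulAut.conj j • ((D.deltaTpH ⊓ D.levelTp (T.Jhat i)).map D.DeltaTp.subtype)) →
      L.act i t (L.vtxCusp i x) ∈ L.compH i)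
    (hblk : L.IsBlock) (hstab : L.StabLeDeltaHLevel) (i : T.I) (x : D.Cusp) (t : D.PiTp) (J : Subgroup D.PiHat)
    (hJ : J ≤ (MulAut.conj t • ((D.inertiaTp x).map D.DeltaTp.subtype)).map D.ιX)
    (hfi : J.relIndex ((MulAut.conj t • ((D.inertiaTp x).map D.DeltaTp.subtype)).map D.ιX) ≠ 0)
    (hmeet : J ≤ (D.deltaTpH.map D.ιΔ).map D.DeltaHat.subtype) {g' : D.PiHat} (hg : g' ∈ D.ιX.range)
    (hgΔ : g' ∈ D.DeltaHat) (hc : MulAut.conj g' • J ≤ (D.deltaTpH.map D.ιΔ).map D.DeltaHat.subtype) :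
    ∃ k' ∈ (D.deltaTpH.map D.ιΔ).map D.DeltaHat.subtype, k'⁻¹ * g' ∈ T.Jhat i := by
  obtain ⟨γ, rfl⟩ := exists_deltaTp_of_mem_range_of_mem_deltaHat hg hgΔ
  set ID : Subgroup D.PiTp := J.comap D.ιX with hID
  have h1 : ID ≤ MulAut.conj t • ((D.inertiaTp x).map D.DeltaTp.subtype) := by
    intro y hy
    obtain ⟨z, hz, hzy⟩ := hJ hy
    rwa [← D.ιX_injective hzy]
  have h2 : ID.relIndex (MulAut.conj t • ((D.inertiaTp x).map D.DeltaTp.subtype)) ≠ 0 := by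
    rw [hID, Subgroup.relIndex_comap]
    exact hfi
  have h3 : ID ≤ D.deltaTpH.map D.DeltaTp.subtype := fun y hy => (D.mem_deltaTpH_map_iff y).mpr (hmeet hy)
  have h4 : MulAut.conj (γ : D.PiTp) • ID ≤ D.deltaTpH.map D.DeltaTp.subtype := by
    intro y hy
    refine (D.mem_deltaTpH_map_iff y).mpr (hc ?_)
    rw [Subgroup.mem_pointwise_smul_iff_inv_smul_mem] at hy ⊢
    have hy' : D.ιX ((MulAut.conj (γ : D.PiTp))⁻¹ • y) ∈ J := hy
    simpa [MulAut.smul_def, MulAut.conj_inv_apply, map_mul, map_inv] using hy'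
  obtain ⟨k, hk, hj⟩ := L.levelTarget_fi_of_inputs hN hincO hblk hstab i x t ID h1 h2 h3 γ h4
  refine ⟨D.ιX (k : D.PiTp), ⟨D.ιΔ k, ⟨k, hk, rfl⟩, rfl⟩, ?_⟩
  rw [← map_inv, ← map_mul]
  exact (D.mem_levelTp).mp hj

end SubgraphLevelData
end Prop24Tower
end StableCurveTemperedData
end Literature.IUT.HodgeTheaters

/-! ## § 2. `γ' ∈ Δ^±_{v□}` without tower-placement binders -/

namespace Literature.IUT.HodgeArakelov

open Literature.IUT.HodgeTheaters Topology
open Literature.AnabelianGeometry.SemiGraphs (IsProSigma)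
open scoped Pointwise

namespace PlusMinusTower

namespace StableCurveAgreement

variable {S : BadPlaceSetting.{u}} {P : TopGroup.{u}} {T : TemperedCoverings S P}
  {W : PlusMinusTower T} {C : CuspidalInertiaData W} {D : StableCurveTemperedData.{u}}

/-- **IUTchII:Cor2.4(i)** (kurims p.70 l.−2 – p.71 l.4) **Inputs (B)+(C) with the incidence in the "[CombGC] Prop 1.2 (ii)"
form and NO tower-placement binder.**  HYPOTHESES (none asserted): the agreement + `Δ`-dictionary; level data
with `LevelsNormal`, `hincO`, `IsBlock`, `StabLeDeltaHLevel`; images of the levels shrinking in `Π̂_𝔾` (`hU`); `Π̂_ℍ` closed;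
Cor 2.3 (v); Def 2.3 (ii)′ (`I_t = I' ∩ Π_v` of FINITE INDEX in a cuspidal inertia group `I'` of `Π^±_v`); `hI`, `hIΔ`.  CONCLUSION: for `γ' ∈ Δ^±_v`, `I^{γ'}_t ⊆ Π^±_{v□} ⟹ γ' ∈ Δ^±_{v□}`.  PROVED: `J := ê(I_t ∩
Π̂^±_v)` has finite index in `ê(I') = ι(t I_x t⁻¹)` (`inertia_iff` + the finite-index clause of Def 2.3 (ii)′ transported along
`ê`), so `levelTarget_fi_hat` applies at every level; then `mem_deltaTpH_of_graphLevels` and the dictionary.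
[claim: Mochizuki2012, status: disputed] -/
theorem mem_deltaPmBox_of_openIncidence (A : StableCurveAgreement W C D) {H : Subgroup P}
    (Dic : A.SubgraphDictionary H) (Tw : D.Prop24Tower) (Lv : Tw.SubgraphLevelData) (hN : Tw.LevelsNormal)
    (hincO : ∀ i (x : D.Cusp) (t : D.PiTp) (M : Subgroup D.PiTp),
      M ≤ MulAut.conj t • ((D.inertiaTp x).map D.DeltaTp.subtype) ⊓ (D.levelTp (Tw.Jhat i)).map D.DeltaTp.subtype →
      M.relIndex (MulAut.conj t • ((D.inertiaTp x).map D.DeltaTp.subtype) ⊓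
        (D.levelTp (Tw.Jhat i)).map D.DeltaTp.subtype) ≠ 0 →
      (∃ j ∈ (D.levelTp (Tw.Jhat i)).map D.DeltaTp.subtype,
        M ≤ MulAut.conj j • ((D.deltaTpH ⊓ D.levelTp (Tw.Jhat i)).map D.DeltaTp.subtype)) →
      Lv.act i t (Lv.vtxCusp i x) ∈ Lv.compH i)
    (hblk : Lv.IsBlock) (hstab : Lv.StabLeDeltaHLevel)
    (hU : ∀ O ∈ 𝓝 (1 : D.graph.Hat), ∃ i, ∀ d ∈ D.levelTp (Tw.Jhat i), D.graph.ι (D.ρTp d) ∈ O)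
    (hHatH : IsClosed (D.graph.HatH : Set D.graph.Hat)) (h23vD : D.Cor23v) (hrel' : Def23_ii' C W.piV W.piPM)
    {I : Subgroup W.Corhat} (hI : C.IsCuspidalInertia W.piV I) (hIΔ : I ≤ W.deltaBox H) :
    ∀ γ' : W.Corhat, γ' ∈ W.piPM ⊓ W.aug.ker →
      I.map (MulAut.conj γ').toMonoidHom ≤ W.pmBox H → γ' ∈ W.deltaPmBox H := by
  intro γ' hγ' hc
  -- `I_t = I' ∩ Π_v`, of finite index in the cuspidal inertia group `I'` of `Π^±_v`; `ê(I') = ι(t I_x t⁻¹)`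
  obtain ⟨I', hI', hfi, hII'⟩ := (hrel'.2.1 I).mp hI
  obtain ⟨hI'pm, x, t, hK⟩ := (A.inertia_iff I').mp hI'
  have hI'hat : I' ≤ W.pmHat := hI'pm.trans W.emb_le_pmHat
  obtain ⟨hγ'pm', hγ'ker⟩ := Subgroup.mem_inf.mp hγ'
  have hγ'pm : γ' ∈ W.pmHat := W.emb_le_pmHat hγ'pm'
  set g' : D.PiHat := A.eHat ⟨γ', hγ'pm⟩ with hg'
  have hg'tp : g' ∈ D.ιX.range := (A.mem_piPM_iff ⟨γ', hγ'pm⟩).mp hγ'pm'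
  have hg'Δ : g' ∈ D.DeltaHat := (A.mem_ker_iff ⟨γ', hγ'pm⟩).mp hγ'ker
  obtain ⟨γ, hγ⟩ := StableCurveTemperedData.exists_deltaTp_of_mem_range_of_mem_deltaHat hg'tp hg'Δ
  set J : Subgroup D.PiHat := (I.subgroupOf W.pmHat).map A.eHat.toMonoidHom with hJ
  have dic : ∀ q : W.pmHat, (q : W.Corhat) ∈ W.deltaPmBox H →
      A.eHat q ∈ (D.deltaTpH.map D.ιΔ).map D.DeltaHat.subtype := by
    intro q hq
    rw [← Dic.deltaPmBox_eq]
    exact ⟨q, Subgroup.mem_subgroupOf.mpr hq, rfl⟩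
  have hIΔ' : I ≤ W.deltaPmBox H := hIΔ.trans (W.deltaBox_le_deltaPmBox H)
  -- (0) `J ⊆ ê(I') = ι(t I_x t⁻¹)`, of finite index
  have hJle : J ≤ (MulAut.conj t • ((D.inertiaTp x).map D.DeltaTp.subtype)).map D.ιX := by
    rw [← hK, hJ, hII']
    exact Subgroup.map_mono (Subgroup.comap_mono inf_le_left)
  have hJfi : J.relIndex ((MulAut.conj t • ((D.inertiaTp x).map D.DeltaTp.subtype)).map D.ιX) ≠ 0 := by
    rw [← hK, hJ, Subgroup.relIndex_map_map_of_injective _ _ A.eHat.injective, hII',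
      Subgroup.relIndex_subgroupOf hI'hat]
    exact hfi.index_ne_zero
  -- (1) `J ⊆ ι(Δ^tp_{X,ℍ})`
  have h2 : J ≤ (D.deltaTpH.map D.ιΔ).map D.DeltaHat.subtype := by
    rintro _ ⟨q, hq, rfl⟩
    exact dic q (hIΔ' (Subgroup.mem_subgroupOf.mp hq))
  -- (2) `J^{g'} ⊆ ι(Δ^tp_{X,ℍ})`
  have hcs : MulAut.conj γ' • I ≤ W.pmBox H := by rw [← map_conj_eq_smul]; exact hc
  have h3 : MulAut.conj g' • J ≤ (D.deltaTpH.map D.ιΔ).map D.DeltaHat.subtype := by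
    rw [hJ, hg', ← map_subgroupOf_conj A.eHat I hγ'pm]
    rintro _ ⟨q, hq, rfl⟩
    have hq' : (q : W.Corhat) ∈ MulAut.conj γ' • I := Subgroup.mem_subgroupOf.mp hq
    refine dic q (Subgroup.mem_inf.mpr ⟨hcs hq', ?_⟩)
    have hz : (MulAut.conj γ')⁻¹ • (q : W.Corhat) ∈ W.aug.ker :=
      (Subgroup.mem_inf.mp (hIΔ' (Subgroup.mem_pointwise_smul_iff_inv_smul_mem.mp hq'))).2
    rw [MulAut.smul_def, MulAut.conj_inv_apply] at hz
    have e : (q : W.Corhat) = γ' * (γ'⁻¹ * q * γ') * γ'⁻¹ := by group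
    rw [e]
    exact W.aug.ker.mul_mem (W.aug.ker.mul_mem hγ'ker hz) (W.aug.ker.inv_mem hγ'ker)
  -- (3) per level, then closure in `Π̂_𝔾` and Cor 2.3 (v)
  have hγH : γ ∈ D.deltaTpH := by
    refine StableCurveTemperedData.mem_deltaTpH_of_graphLevels h23vD hHatH
      (fun i => (D.levelTp (Tw.Jhat i)).map (D.graph.ι.comp D.ρTp)) (fun O hO => ?_) γ (fun i => ?_)
    · obtain ⟨i, hi⟩ := hU O hO
      refine ⟨i, ?_⟩
      rintro _ ⟨d, hd, rfl⟩
      exact hi d hd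
    · obtain ⟨k', hk', hkU⟩ := Lv.levelTarget_fi_hat hN hincO hblk hstab i x t J hJle hJfi h2
        (hγ ▸ hg'tp) (hγ ▸ hg'Δ) (by rw [hγ]; exact h3)
      obtain ⟨_, ⟨k, hk, rfl⟩, rfl⟩ := hk'
      refine ⟨k, hk, ⟨k⁻¹ * γ, (D.mem_levelTp).mpr ?_, rfl⟩⟩
      have e2 : D.ιX ((k⁻¹ * γ : D.DeltaTp) : D.PiTp) = (D.DeltaHat.subtype (D.ιΔ k))⁻¹ * D.ιX (γ : D.PiTp) := by
        rw [Subgroup.coe_mul, Subgroup.coe_inv, map_mul, map_inv]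
        rfl
      rw [e2]
      exact hkU
  -- (4) the dictionary read backwards
  have hmem : A.eHat ⟨γ', hγ'pm⟩ ∈ ((W.deltaPmBox H).subgroupOf W.pmHat).map A.eHat.toMonoidHom := by
    rw [Dic.deltaPmBox_eq, ← hg', ← hγ]
    exact ⟨D.ιΔ γ, ⟨γ, hγH, rfl⟩, rfl⟩
  obtain ⟨q, hq, hqe⟩ := hmem
  rw [MulEquiv.coe_toMonoidHom, A.eHat.apply_eq_iff_eq] at hqe
  have : (q : W.Corhat) = γ' := congrArg Subtype.val hqe
  rw [← this]
  exact Subgroup.mem_subgroupOf.mp hq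

/-- **IUTchII:Cor2.4(i)** (kurims pp.70–71) The same over an ADMISSIBLE tower (adapter of p421400: `Ĵ_i ∩ Δ̂_X = ρ̂⁻¹(V_i)`, B4
core by abc-iut-w4-d076's realisation, B1 (c) from (D3) stabilisers + density) — no `hlevV`, no `hinf`. PROVED.
[claim: Mochizuki2012, status: disputed] -/
theorem mem_deltaPmBox_of_graphTowerOpen (A : StableCurveAgreement W C D) {H : Subgroup P}
    (Dic : A.SubgraphDictionary H) (Tw : D.Prop24Tower) (V : Tw.I → Subgroup D.graph.Hat)
    (hJhat : ∀ i (y : D.DeltaHat), (y : D.PiHat) ∈ Tw.Jhat i ↔ D.ρHat y ∈ V i) (hVn : ∀ i, (V i).Normal)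
    (hVo : ∀ i, IsOpen (V i : Set D.graph.Hat)) (hV : ∀ O ∈ 𝓝 (1 : D.graph.Hat), ∃ i, (V i : Set D.graph.Hat) ⊆ O)
    (Cv : Tw.CoveringLevelGraphs)
    (hincO : ∀ i (x : D.Cusp) (t : D.PiTp) (M : Subgroup D.PiTp),
      M ≤ MulAut.conj t • ((D.inertiaTp x).map D.DeltaTp.subtype) ⊓ (D.levelTp (Tw.Jhat i)).map D.DeltaTp.subtype →
      M.relIndex (MulAut.conj t • ((D.inertiaTp x).map D.DeltaTp.subtype) ⊓
        (D.levelTp (Tw.Jhat i)).map D.DeltaTp.subtype) ≠ 0 →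
      (∃ j ∈ (D.levelTp (Tw.Jhat i)).map D.DeltaTp.subtype,
        M ≤ MulAut.conj j • ((D.deltaTpH ⊓ D.levelTp (Tw.Jhat i)).map D.DeltaTp.subtype)) →
      Cv.toLevelData.act i t (Cv.toLevelData.vtxCusp i x) ∈ Cv.toLevelData.compH i)
    (hst : ∀ i (γ : D.DeltaTp), (∀ v ∈ Cv.toLevelData.compH i, Cv.toLevelData.act i (γ : D.PiTp) v ∈
        Cv.toLevelData.compH i) → ∃ ĥ ∈ D.graph.HatH, ĥ⁻¹ * D.graph.ι (D.ρTp γ) ∈ V i)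
    (hdense : (D.graph.HatH : Set D.graph.Hat) ⊆ closure ((D.graph.TpH.map D.graph.ι : Subgroup D.graph.Hat) : Set _))
    (hHatH : IsClosed (D.graph.HatH : Set D.graph.Hat)) (h23vD : D.Cor23v) (hrel' : Def23_ii' C W.piV W.piPM)
    {I : Subgroup W.Corhat} (hI : C.IsCuspidalInertia W.piV I) (hIΔ : I ≤ W.deltaBox H) :
    ∀ γ' : W.Corhat, γ' ∈ W.piPM ⊓ W.aug.ker →
      I.map (MulAut.conj γ').toMonoidHom ≤ W.pmBox H → γ' ∈ W.deltaPmBox H :=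
  A.mem_deltaPmBox_of_openIncidence Dic Tw Cv.toLevelData (Tw.levelsNormal_of_graphLevels V hJhat hVn) hincO
    Cv.toLevelData_isBlock (Cv.toLevelData.stabLeDeltaHLevel_of_graphLevels V hJhat hVo hdense hst)
    (Tw.images_shrink_of_graphLevels V hJhat hV) hHatH h23vD hrel' hI hIΔ

end StableCurveAgreement
end PlusMinusTower

/-! ## § 3. The closers -/

section ClosersOpen

open Literature.IUT.HodgeTheaters Topology
open Literature.AnabelianGeometry.SemiGraphs (IsProSigma)
open scoped Pointwise

variable {S : BadPlaceSetting.{u}} {P : TopGroup.{u}} {T : TemperedCoverings S P}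
  {D : EtaleThetaData S.toThetaSetting P} {Dsc : StableCurveTemperedData.{u}}
  (Dec : SubgraphDecomposition S T D) (W : PlusMinusTower T) (C : CuspidalInertiaData W)
  {L : LabCuspStructure C} (Ld : LabelledDecomposition Dec L) (I : Subgroup W.Corhat)

/-- **IUTchII:Cor2.4(i)′ — closer, "[CombGC] Prop 1.2 (ii)" form, admissible tower, no placement binders** (kurims pp.69–71):
`Cor24_i' Dec W C Ld I` from {`A`, Prop 2.4 (i), Def 2.3 (ii)′, `e : I_x ≃ₜ* Ẑ`} and, per admissible `Π_{v□}`, `GraphTowerOpen` =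
{`D'`, agreement, `Δ`-dictionary, Cor 2.3 (v), `Π̂_ℍ` closed, `Π^tp_ℍ` dense, tower `ρ̂⁻¹(V_i)` with `V_i ⊴ Π̂_𝔾` open shrinking to
`1`, semi-graph realisation, open-subgroup incidence, (D3) stabilisers}.  ALL HYPOTHESES.  PROVED.
[claim: Mochizuki2012, status: disputed] -/
theorem cor24_i'_of_openIncidence_byGraph (A : W.StableCurveAgreement C Dsc) (h24i : Dsc.Prop24i)
    (hrel' : Def23_ii' C W.piV W.piPM) (e : ∀ x : Dsc.Cusp, ↥(Dsc.inertiaTp x) ≃ₜ* HodgeTheaters.ZHat)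
    (GraphTowerOpen : ∀ H : Subgroup P, Cor24_family Dec Ld H →
      ∃ (D' : StableCurveTemperedData.{u}) (A' : W.StableCurveAgreement C D') (_ : A'.SubgraphDictionary H)
        (_ : D'.Cor23v) (_ : IsClosed (D'.graph.HatH : Set D'.graph.Hat))
        (_ : (D'.graph.HatH : Set D'.graph.Hat) ⊆
          closure ((D'.graph.TpH.map D'.graph.ι : Subgroup D'.graph.Hat) : Set _))
        (Tw : D'.Prop24Tower) (V : Tw.I → Subgroup D'.graph.Hat)
        (_ : ∀ i (y : D'.DeltaHat), (y : D'.PiHat) ∈ Tw.Jhat i ↔ D'.ρHat y ∈ V i) (_ : ∀ i, (V i).Normal)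
        (_ : ∀ i, IsOpen (V i : Set D'.graph.Hat))
        (_ : ∀ O ∈ 𝓝 (1 : D'.graph.Hat), ∃ i, (V i : Set D'.graph.Hat) ⊆ O)
        (Cv : Tw.CoveringLevelGraphs),
        (∀ i (x : D'.Cusp) (t : D'.PiTp) (M : Subgroup D'.PiTp),
          M ≤ MulAut.conj t • ((D'.inertiaTp x).map D'.DeltaTp.subtype) ⊓
            (D'.levelTp (Tw.Jhat i)).map D'.DeltaTp.subtype →
          M.relIndex (MulAut.conj t • ((D'.inertiaTp x).map D'.DeltaTp.subtype) ⊓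
            (D'.levelTp (Tw.Jhat i)).map D'.DeltaTp.subtype) ≠ 0 →
          (∃ j ∈ (D'.levelTp (Tw.Jhat i)).map D'.DeltaTp.subtype,
            M ≤ MulAut.conj j • ((D'.deltaTpH ⊓ D'.levelTp (Tw.Jhat i)).map D'.DeltaTp.subtype)) →
          Cv.toLevelData.act i t (Cv.toLevelData.vtxCusp i x) ∈ Cv.toLevelData.compH i) ∧
        (∀ i (γ : D'.DeltaTp), (∀ v ∈ Cv.toLevelData.compH i, Cv.toLevelData.act i (γ : D'.PiTp) v ∈
          Cv.toLevelData.compH i) → ∃ ĥ ∈ D'.graph.HatH, ĥ⁻¹ * D'.graph.ι (D'.ρTp γ) ∈ V i)) :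
    Literature.IUT.HodgeArakelov.Cor24_i' Dec W C Ld I :=
  fun H hH => cor24_i_of_inputs_mem W C H I
    (fun hI hIΔ => A.inputA_of_prop24i h24i (hIΔ.trans (inf_le_right : W.deltaBox H ≤ W.aug.ker))
      (A.hΛ_of_equiv_zHat_of_def23ii' hrel' e I hI))
    (fun hI hIΔ => by
      obtain ⟨D', A', hDic, h23vD, hHatH, hdense, Tw, V, hJhat, hVn, hVo, hV, Cv, hincO, hst⟩ := GraphTowerOpen H hH
      exact A'.mem_deltaPmBox_of_graphTowerOpen hDic Tw V hJhat hVn hVo hV Cv hincO hst hdense hHatH h23vD hrel'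
        hI hIΔ)

/-- **IUTchII:Cor2.4(ii)(iii)′ — closer, "[CombGC] Prop 1.2 (ii)" form, admissible tower, no placement binders** (kurims p.70):
`Cor24_ii_iii' W C H` with (B)+(C) per `□'` from `GraphTowerOpen`; other inputs (`Prop24i`, `Cor23Hyp`, `Cor23iii`, `hBox`,
`Def23_ii'`, `e`, `hcap`, `hYdd`) as in the landed closers — ALL HYPOTHESES.  PROVED. [claim: Mochizuki2012, status: disputed] -/
theorem cor24_ii_iii'_of_openIncidence_byGraph {H : Subgroup P} (hH : Cor24_family Dec Ld H)
    (A : W.StableCurveAgreement C Dsc) (h24i : Dsc.Prop24i) (hHyp : Dsc.Cor23Hyp) (h23iii : Dsc.Cor23iii)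
    (hrel' : Def23_ii' C W.piV W.piPM) (e : ∀ x : Dsc.Cusp, ↥(Dsc.inertiaTp x) ≃ₜ* HodgeTheaters.ZHat)
    (GraphTowerOpen : ∀ H' : Subgroup P, Cor24_family Dec Ld H' →
      ∃ (D' : StableCurveTemperedData.{u}) (A' : W.StableCurveAgreement C D') (_ : A'.SubgraphDictionary H')
        (_ : D'.Cor23v) (_ : IsClosed (D'.graph.HatH : Set D'.graph.Hat))
        (_ : (D'.graph.HatH : Set D'.graph.Hat) ⊆
          closure ((D'.graph.TpH.map D'.graph.ι : Subgroup D'.graph.Hat) : Set _))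
        (Tw : D'.Prop24Tower) (V : Tw.I → Subgroup D'.graph.Hat)
        (_ : ∀ i (y : D'.DeltaHat), (y : D'.PiHat) ∈ Tw.Jhat i ↔ D'.ρHat y ∈ V i) (_ : ∀ i, (V i).Normal)
        (_ : ∀ i, IsOpen (V i : Set D'.graph.Hat))
        (_ : ∀ O ∈ 𝓝 (1 : D'.graph.Hat), ∃ i, (V i : Set D'.graph.Hat) ⊆ O)
        (Cv : Tw.CoveringLevelGraphs),
        (∀ i (x : D'.Cusp) (t : D'.PiTp) (M : Subgroup D'.PiTp),
          M ≤ MulAut.conj t • ((D'.inertiaTp x).map D'.DeltaTp.subtype) ⊓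
            (D'.levelTp (Tw.Jhat i)).map D'.DeltaTp.subtype →
          M.relIndex (MulAut.conj t • ((D'.inertiaTp x).map D'.DeltaTp.subtype) ⊓
            (D'.levelTp (Tw.Jhat i)).map D'.DeltaTp.subtype) ≠ 0 →
          (∃ j ∈ (D'.levelTp (Tw.Jhat i)).map D'.DeltaTp.subtype,
            M ≤ MulAut.conj j • ((D'.deltaTpH ⊓ D'.levelTp (Tw.Jhat i)).map D'.DeltaTp.subtype)) →
          Cv.toLevelData.act i t (Cv.toLevelData.vtxCusp i x) ∈ Cv.toLevelData.compH i) ∧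
        (∀ i (γ : D'.DeltaTp), (∀ v ∈ Cv.toLevelData.compH i, Cv.toLevelData.act i (γ : D'.PiTp) v ∈
          Cv.toLevelData.compH i) → ∃ ĥ ∈ D'.graph.HatH, ĥ⁻¹ * D'.graph.ι (D'.ρTp γ) ∈ V i))
    (hBox : ((W.pmBox H).subgroupOf W.pmHat).map A.eHat.toMonoidHom = Dsc.piTpXH.map Dsc.ιX)
    (hcap : W.pmBox H ⊓ W.piV ≤ W.box H)
    (hYdd : ∀ I : Subgroup W.Corhat, C.IsCuspidalInertia W.piV I → I ≤ W.deltaBox H →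
      W.cuspDecomp I 1 ≤ (T.YddL).map (W.emb.comp T.incl)) :
    Literature.IUT.HodgeArakelov.Cor24_ii_iii' W C H :=
  cor24_ii_iii'_of_inputs
    (fun I _ _ => cor24_i'_of_openIncidence_byGraph Dec W C Ld I A h24i hrel' e GraphTowerOpen H hH)
    (A.boxOntoGalois_of_cor23iii hBox hHyp h23iii) hcap hYdd

end ClosersOpen

end Literature.IUT.HodgeArakelov
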